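import Literature.NumberTheory.ConnesConsani2021.SemilocalSoninSpace
import HarnessLib

/-!
# SemilocalSoninIneqOn — OPEN OBLIGATION (not in print): the Connes–Consani-shaped semilocal inequality at `S = {∞, p}`

Cell `rh-explicit` (HOME `run/shared/lean/pub/rh-explicit/`, seat cc-s2-1; PLAN §1.3 (a)).  These `Prop`s are
what the cell calls "the S = {∞,2} Connes–Consani operator statement": the literal transport of
A. Connes, C. Consani, *Weil positivity and trace formula, the archimedean place*, Selecta Math. 27 (2021),
Theorem 1 (arXiv:2006.13771 p. 4) to the finite set of places `S = {∞, p}`, with the semilocal Sonin space of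
Connes–Consani–Moscovici 2024 (Def. 4.5 / Thm. 4.6; tree `Literature.NumberTheory.ConnesConsani2021.semilocalSoninSpace`)
in place of Sonin's space.  NOT PRINTED ANYWHERE as a theorem or a numbered conjecture (CC 2021 p. 3 and CCM 2024
p. 3 name the step as a programme; search record `HOME/cc-s2-1/MEMO.md` §3, 2026-08-21); typed so that the cell can
certify, refute or prove them.  Internal finite-section numerics (cell `pub-rhdoor`, LADDER.md §4 A19, three
engines, 2026-08-20) SUPPORT `SemilocalSoninIneqOn 2 (log 2 / 2)` (0 positive directions at Galerkin order ≤ 14,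
margin ≈ 1.4e-2) and CONTRADICT `SemilocalSoninIneqOn 2 (log 3 / 2)` (2–4 positive directions) — DATA, neither a
theorem nor a refutation.  The scalar shadow (empty family) on the `S = {∞,2}` window is PROVED in the tree
(`Literature.NumberTheory.ConnesConsani2021.semilocalWeilSide_re_nonneg_two`, from `weilPositivityOn_log_three_half`).
No RH claim.  Filing: obligation node of `RiemannHypothesis/RiemannHypothesis` (gate lint `literature.conjecture` keeps it out of
Literature/); a proof or refutation goes in a sibling Theorems file.  Statements typed by seat cc-s2-1
(`HOME/cc-s2-1/S2-STATEMENT.md` §2), filed through the gate by seat cc-s2-4 (`HOME/cc-s2-4/CC4-LEAN.md` §1) as a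
helper of the WeilPos item `WeilposThesis` (∀ a > 0, WeilPositivityOn a), of which the scalar shadow of
`SemilocalSoninIneqOn 2 a`, `a ≤ (log 3)/2`, is a case (`semilocalSoninIneqOn_two_scalar_shadow` below).
-/

set_option linter.dupNamespace false  -- the mandated namespace repeats `RiemannHypothesis`

noncomputable section

open MeasureTheory Complex Set
open scoped Real

namespace Summit.RiemannHypothesis.RiemannHypothesis

open Literature.NumberTheory.LFunctions Literature.NumberTheory.ConnesConsani2021

/-- **"Theorem 1_S", the literal `S = {∞, p}` transport of CC 2021 Theorem 1 — NOT A PRINTED STATEMENT**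
(CC 2021 p. 3 and CCM 2024 p. 3 name the step as a programme; no theorem, no numbered conjecture; cell
`rh-explicit`, `HOME/cc-s2-1/MEMO.md` §3).  For every Weil test function `g` supported in `[−a, a]` with
CC's two vanishing conditions `f̂(i/2) = 0`, `f̂(0) = 0` (`mulFourier`, i.e. `ĝ(1) = ĝ(1/2) = 0`) and every
finite orthonormal family `ξ₁, …, ξₙ` of `L²(ℝ)` in the semilocal Sonin space `𝔖_S(1,1)`, `S = {∞, p}`:
`Σ_i Re⟨ξ_i | ϑ(g ∗ g*) ξ_i⟩ ≤ Re(W_∞(g ∗ g*) − W_p(g ∗ g*))` — weak-trace typing of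
"`W_∞(g∗g*) − W_p(g∗g*) ≥ Tr(ϑ(g) 𝔖_S ϑ(g)*)`" exactly as in `WeilArchPositivity_soninTrace` (module
docstring there, "How the trace is typed"), with CC's `W_p(f) = (log p)Σ_{m≥1} p^{−m/2}(f(p^m) + f(p^{−m}))
= weilSemilocalPrimeTerm {p}` of the additive avatar and the sign of Weil's criterion `Σ_v W_v(g ∗ g*) ≤ 0`.
The cell's target windows: `p = 2`, `a = (log 2)/2` (CC's own window, prime-free on the Weil side, the
prime inside `𝔖_S`) and `a = (log 3)/2` (the `S = {∞,2}` window).  STATUS: open; NOT asserted by its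
authors; finite-section numerics of cell `pub-rhdoor` (LADDER.md §4 A19) support the first and contradict
the second.  Typed so that it can be settled either way. [cite: ConnesConsani2021, Intro p. 3 (the semi-local programme sentence); Thm. 1 p. 4 (the archimedean shape)] -/
@[conjecture] def SemilocalSoninIneqOn (p : ℕ) [Fact p.Prime] (a : ℝ) : Prop :=
  ∀ g : ℝ → ℂ, IsWeilTest g → tsupport g ⊆ Icc (-a) a →
    mulFourier g (I / 2) = 0 → mulFourier g 0 = 0 →
    ∀ (n : ℕ) (ξ : Fin n → Lp ℂ 2 (volume : Measure ℝ)),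
      Orthonormal ℂ ξ → (∀ i, ξ i ∈ semilocalSoninSpace p 1 1) →
        ∑ i, (soninTraceForm (weilConv g (weilReflect g)) (ξ i : ℝ → ℂ)).re
          ≤ (archW (weilConv g (weilReflect g))
              - weilSemilocalPrimeTerm {p} (weilConv g (weilReflect g))).re

/-- **The finite-codimension form ("Theorem 3.6_S" shape) — NOT A PRINTED STATEMENT.**  CC 2021 prove at
`S = {∞}` (Prop. 3.5 / Thm. 3.6, p. 13: "one needs to impose only finitely many linear conditions on test
functions to obtain `D∘Q ≤ 0` and hence `W_∞ ≥ 0` on `C_c^∞(I) ∩ 𝒥`") that on EVERY bounded window finitely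
many linear conditions give positivity; the Sonin-trace version with a prime would read: there are finitely
many linear functionals `ℓ₁, …, ℓₙ` on functions `ℝ → ℂ` such that every Weil test `g` supported in `[−a, a]`
with `ℓ_j(g) = 0` for all `j` satisfies the inequality of `SemilocalSoninIneqOn`.  At `S ∋ p` the printed
mechanism for this (Thm. 3.6's `−2·Id + compact`) is known to the cell NOT to transport (gap G1 of cell
`pub-rhdoor`, LOCATED-GAP.md: the semilocal trace-remainder is log-singular on `p^ℤ`); the statement itself
is open.  The number `n` is the "found object" of the cell's (Op-b) target. [cite: ConnesConsani2021, Prop. 3.5 / Thm. 3.6 p. 13 (the archimedean finite-codimension statement)] -/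
@[conjecture] def SemilocalSoninIneqFinCodimOn (p : ℕ) [Fact p.Prime] (a : ℝ) : Prop :=
  ∃ (n : ℕ) (ℓ : Fin n → (ℝ → ℂ) →ₗ[ℂ] ℂ),
    ∀ g : ℝ → ℂ, IsWeilTest g → tsupport g ⊆ Icc (-a) a → (∀ j, ℓ j g = 0) →
      ∀ (m : ℕ) (ξ : Fin m → Lp ℂ 2 (volume : Measure ℝ)),
        Orthonormal ℂ ξ → (∀ i, ξ i ∈ semilocalSoninSpace p 1 1) →
          ∑ i, (soninTraceForm (weilConv g (weilReflect g)) (ξ i : ℝ → ℂ)).re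
            ≤ (archW (weilConv g (weilReflect g))
                - weilSemilocalPrimeTerm {p} (weilConv g (weilReflect g))).re

/-- Monotonicity in the window: the statement on `[−b, b]` implies it on every smaller window. [folklore] -/
theorem SemilocalSoninIneqOn.mono {p : ℕ} [Fact p.Prime] {a b : ℝ} (h : SemilocalSoninIneqOn p b)
    (hab : a ≤ b) : SemilocalSoninIneqOn p a :=
  fun g hg hsupp h1 h0 n ξ hξ hS ↦
    h g hg (hsupp.trans (Icc_subset_Icc (neg_le_neg hab) hab)) h1 h0 n ξ hξ hS


/-- The empty family: `SemilocalSoninIneqOn p a` contains the scalar statement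
`0 ≤ Re(W_∞(g∗g*) − W_p(g∗g*))` on its class (take `n = 0`). [folklore] -/
theorem SemilocalSoninIneqOn.scalar {p : ℕ} [Fact p.Prime] {a : ℝ} (h : SemilocalSoninIneqOn p a)
    {g : ℝ → ℂ} (hg : IsWeilTest g) (hsupp : tsupport g ⊆ Icc (-a) a)
    (h1 : mulFourier g (I / 2) = 0) (h0 : mulFourier g 0 = 0) :
    0 ≤ (archW (weilConv g (weilReflect g))
      - weilSemilocalPrimeTerm {p} (weilConv g (weilReflect g))).re := by
  simpa using h g hg hsupp h1 h0 0 (fun i => Fin.elim0 i)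
    ⟨fun i => Fin.elim0 i, fun i => Fin.elim0 i⟩ (fun i => Fin.elim0 i)


/-- **What is already a theorem of the tree on the `S = {∞,2}` window**: the scalar conclusion of
`SemilocalSoninIneqOn 2 a` (empty family) holds unconditionally for every `a ≤ (log 3)/2` — it is the PROVED
rung `weilPositivityOn_log_three_half` read through the factor-1 dictionary
(`Literature.NumberTheory.ConnesConsani2021.semilocalWeilSide_re_nonneg_two`).  So on this window the open
content of `SemilocalSoninIneqOn 2 a` is exactly the Sonin-trace lower bound `n ≥ 1`. [folklore] -/
theorem semilocalSoninIneqOn_two_scalar_shadow {a : ℝ} (ha : a ≤ Real.log 3 / 2)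
    {g : ℝ → ℂ} (hg : IsWeilTest g) (hsupp : tsupport g ⊆ Icc (-a) a)
    (h1 : mulFourier g (I / 2) = 0) :
    0 ≤ (archW (weilConv g (weilReflect g))
      - weilSemilocalPrimeTerm {2} (weilConv g (weilReflect g))).re :=
  semilocalWeilSide_re_nonneg_two hg (hsupp.trans (Icc_subset_Icc (neg_le_neg ha) ha)) h1

end Summit.RiemannHypothesis.RiemannHypothesis
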